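import Literature.Computability.Complexity.MachinPiFP
import Mathlib.Analysis.Real.Pi.Bounds
import HarnessLib

/-!
# Realisable Gaussian widths for Regev's classical reduction: the common factor `√(π/π⁺)` of an exact sampler

Topic `Computability/Cryptography` (family `pqc`), grouping namespace `Regev2009.Widths`. The machine of
Regev's Lemma 3.4 (the `CVP` procedure of Theorem 3.1, pqc.S19, and of Peikert's Prop. 3.2, pqc.S20)
draws every Gaussian noise by the coin-driven rejection sampler of
`Probability/Distributions/GaussianRejectionSampler.lean` / `Cryptography/RejectionSamplerCoins.lean`,
which samples `D_{ℤ,S,c}` for a RATIONAL `θ = π/S²` exactly (up to its own negligible error). The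
target widths of the reduction are `S = L·σ` with `σ²` rational (`α(n)` is rational,
`IsPolyTimeParams`; `σ² = α²/2`, `α²/2 + k·α̃²/K_g`, …), so `θ = π/(L²σ²)` is NOT rational; the
machine uses instead `θ⁺ = π⁺_p/(L²σ²)` with the rational upper bound `π⁺_p = piApprox p + 2⁻ᵖ/2 ≥ π`
of `MachinPiFP.lean`, i.e. it realises the width `S·λ_p` with the common factor
`λ_p = √(π/π⁺_p) ∈ [1 − 2⁻ᵖ, 1]`. The law files of the reduction with a kernel oracle
(`RegevLWESolveKernelGrid.lean`, `RegevBDDRoundKernel.lean`, `RegevDigitLoopKernel.lean`) were written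
with exactly this freedom (a base noise `α₀ ∈ [α/2, α/√2]`, a grid width `α̃ ∈ [α, (1+1/K_g)α]`); this
file supplies the two widths and their bracketing:

* `piUpper p = piApprox p + 1/(2·2ᵖ)`, `pi_le_piUpper`, `piUpper_le_pi_add`, `lam p = √(π/piUpper p)`,
  `lam_le_one`, `one_sub_le_lam` (`1 − 2⁻ᵖ ≤ λ_p`, from `π ≥ 1/2 · …`; in fact `1 − 2⁻ᵖ/6 ≤ λ_p`);
* `baseNoise α p = λ_p · α/√2` with **`baseNoise_le`** (`≤ α/√2`) and **`half_le_baseNoise`**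
  (`α/2 ≤ ·`, every `p`);
* `gridWidth α K_g p = λ_p (1 + 1/(2K_g)) α` with **`le_gridWidth`** (`α ≤ ·` once `2ᵖ ≥ 2(2K_g+1)`) and
  **`gridWidth_le`** (`≤ (1 + 1/K_g) α`);
* the sampler's parameter: `theta p L σsq = piUpper p / (L² σsq)` and **`sqrt_pi_div_theta`**:
  `√(π/θ) = λ_p · L · √σsq` — the realised width.

Everything here is PROVED; the definitions have bodies; no named fact.

## References

* O. Regev, *On lattices, learning with errors, random linear codes, and cryptography*, J. ACM 56
  (2009), art. 34, §2 p. 11 (the finite-precision model) and Lemmas 3.7, 3.11 [Regev2009].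
* C. Peikert, *Public-key cryptosystems from the worst-case shortest vector problem*, STOC 2009, full
  version p. 7 ("a suitable amount of precision") [Peikert2009].
* J. M. Borwein, P. B. Borwein, *Pi and the AGM*, Wiley 1987, §11.1 [BorweinBorwein1987].
-/

noncomputable section

namespace Literature.Computability.Cryptography

namespace Regev2009

namespace Widths

open Real Literature.Computability.Complexity.MachinPi

/-! ### The rational upper bound of `π` and the common width factor -/

/-- **A rational upper bound of `π` to precision `2⁻ᵖ`**: `piApprox p + 2⁻ᵖ/2`. [folklore] -/
def piUpper (p : ℕ) : ℚ := piApprox p + 1 / (2 * 2 ^ p)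

/-- `π ≤ π⁺_p`. [cite: BorweinBorwein1987, §11.1] -/
theorem pi_le_piUpper (p : ℕ) : π ≤ (piUpper p : ℝ) := by
  have h := abs_pi_sub_piApprox_le p
  rw [abs_le] at h
  unfold piUpper
  push_cast
  linarith [h.2]

/-- `π⁺_p ≤ π + 2⁻ᵖ`. [cite: BorweinBorwein1987, §11.1] -/
theorem piUpper_le_pi_add (p : ℕ) : (piUpper p : ℝ) ≤ π + 1 / 2 ^ p := by
  have h := abs_pi_sub_piApprox_le p
  rw [abs_le] at h
  unfold piUpper
  push_cast
  have : (1 : ℝ) / (2 * 2 ^ p) + 1 / (2 * 2 ^ p) = 1 / 2 ^ p := by ring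
  linarith [h.1]

/-- `0 < π⁺_p`. [folklore] -/
theorem piUpper_pos (p : ℕ) : 0 < (piUpper p : ℝ) := pi_pos.trans_le (pi_le_piUpper p)

/-- **The common factor of the realised widths**: `λ_p = √(π/π⁺_p)`. [folklore] -/
def lam (p : ℕ) : ℝ := Real.sqrt (π / piUpper p)

/-- `0 < λ_p`. [folklore] -/
theorem lam_pos (p : ℕ) : 0 < lam p := Real.sqrt_pos.2 (div_pos pi_pos (piUpper_pos p))

/-- `λ_p ≤ 1`. [folklore] -/
theorem lam_le_one (p : ℕ) : lam p ≤ 1 := by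
  unfold lam
  rw [Real.sqrt_le_one]
  exact (div_le_one (piUpper_pos p)).2 (pi_le_piUpper p)

/-- `λ_p² = π/π⁺_p`. [folklore] -/
theorem lam_sq (p : ℕ) : lam p ^ 2 = π / piUpper p := Real.sq_sqrt (div_pos pi_pos (piUpper_pos p)).le

/-- **`1 − 2⁻ᵖ ≤ λ_p`** (indeed `λ_p² = π/π⁺ ≥ π/(π + 2⁻ᵖ) ≥ 1 − 2⁻ᵖ/π`). [folklore] -/
theorem one_sub_le_lam (p : ℕ) : 1 - 1 / 2 ^ p ≤ lam p := by
  have h2p : (0 : ℝ) < 2 ^ p := by positivity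
  have hx : (0 : ℝ) ≤ 1 / 2 ^ p := by positivity
  by_cases hle : (1 : ℝ) / 2 ^ p ≤ 1
  · -- `(1 - x)² ≤ 1 - x ≤ π/(π + x) ≤ λ²`
    have h1 : 0 ≤ 1 - (1 : ℝ) / 2 ^ p := by linarith
    have hsq : (1 - (1 : ℝ) / 2 ^ p) ^ 2 ≤ lam p ^ 2 := by
      rw [lam_sq]
      have hden : 0 < π + 1 / 2 ^ p := by positivity
      calc (1 - (1 : ℝ) / 2 ^ p) ^ 2 ≤ 1 - 1 / 2 ^ p := by nlinarith
        _ ≤ π / (π + 1 / 2 ^ p) := by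
            rw [le_div_iff₀ hden]
            nlinarith [Real.pi_gt_three]
        _ ≤ π / piUpper p := div_le_div_of_nonneg_left pi_pos.le (piUpper_pos p) (piUpper_le_pi_add p)
    exact (pow_le_pow_iff_left₀ h1 (lam_pos p).le two_ne_zero).1 hsq
  · linarith [lam_pos p]

/-! ### The base noise `α₀ = λ_p α/√2` -/

/-- **The realised base noise** of the manufactured samples: `λ_p · α/√2` (Regev's `α/√2`, shrunk by
the sampler's factor). [cite: Regev2009, Lemma 3.11 (noise of standard deviation α/(2√π))] -/
def baseNoise (α : ℝ) (p : ℕ) : ℝ := lam p * (α / Real.sqrt 2)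

/-- `α₀ ≤ α/√2`. [folklore] -/
theorem baseNoise_le {α : ℝ} (hα : 0 ≤ α) (p : ℕ) : baseNoise α p ≤ α / Real.sqrt 2 := by
  unfold baseNoise
  exact mul_le_of_le_one_left (by positivity) (lam_le_one p)

/-- `0 < α₀` for `0 < α`. [folklore] -/
theorem baseNoise_pos {α : ℝ} (hα : 0 < α) (p : ℕ) : 0 < baseNoise α p := by
  unfold baseNoise; exact mul_pos (lam_pos p) (by positivity)

/-- **`α/2 ≤ α₀`** for every precision `p` (`λ_p ≥ √(π/(π + 1)) ≥ 1/√2`). [folklore] -/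
theorem half_le_baseNoise {α : ℝ} (hα : 0 ≤ α) (p : ℕ) : α / 2 ≤ baseNoise α p := by
  -- `λ_p² ≥ π/(π+1) ≥ 1/2`
  have hlam2 : (1 : ℝ) / 2 ≤ lam p ^ 2 := by
    rw [lam_sq]
    have h1 : (1 : ℝ) / 2 ^ p ≤ 1 := by
      rw [div_le_one (by positivity)]; exact one_le_pow₀ one_le_two
    have hden : (piUpper p : ℝ) ≤ π + 1 := (piUpper_le_pi_add p).trans (by linarith)
    calc (1 : ℝ) / 2 ≤ π / (π + 1) := by rw [div_le_div_iff₀ two_pos (by positivity)]; nlinarith [Real.pi_gt_three]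
      _ ≤ π / piUpper p := div_le_div_of_nonneg_left pi_pos.le (piUpper_pos p) hden
  have hlam : 1 / Real.sqrt 2 ≤ lam p := by
    have h0 : (0 : ℝ) ≤ 1 / Real.sqrt 2 := by positivity
    refine (pow_le_pow_iff_left₀ h0 (lam_pos p).le two_ne_zero).1 ?_
    rw [div_pow, one_pow, Real.sq_sqrt zero_le_two]
    exact hlam2
  unfold baseNoise
  have h2 : Real.sqrt 2 * Real.sqrt 2 = 2 := Real.mul_self_sqrt zero_le_two
  have hs : 0 < Real.sqrt 2 := Real.sqrt_pos.2 two_pos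
  calc α / 2 = 1 / Real.sqrt 2 * (α / Real.sqrt 2) := by
        rw [div_mul_div_comm, one_mul, h2]
    _ ≤ lam p * (α / Real.sqrt 2) := mul_le_mul_of_nonneg_right hlam (by positivity)

/-! ### The grid width `α̃ = λ_p (1 + 1/(2K_g)) α` -/

/-- **The realised grid width** of the padding levels of Lemma 3.7: nominal `(1 + 1/(2K_g))α`, shrunk by
the sampler's factor. [cite: Regev2009, Lemma 3.7 (proof: the grid of extra variances)] -/
def gridWidth (α : ℝ) (Kg p : ℕ) : ℝ := lam p * ((1 + 1 / (2 * Kg)) * α)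

/-- **`α̃ ≤ (1 + 1/K_g) α`.** [folklore] -/
theorem gridWidth_le {α : ℝ} (hα : 0 ≤ α) (Kg p : ℕ) : gridWidth α Kg p ≤ (1 + 1 / Kg) * α := by
  unfold gridWidth
  have hK : (0 : ℝ) ≤ 1 / (2 * Kg) := by positivity
  calc lam p * ((1 + 1 / (2 * Kg)) * α) ≤ (1 + 1 / (2 * Kg)) * α :=
        mul_le_of_le_one_left (by positivity) (lam_le_one p)
    _ ≤ (1 + 1 / Kg) * α := by
        refine mul_le_mul_of_nonneg_right ?_ hα
        rcases Nat.eq_zero_or_pos Kg with rfl | hK0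
        · simp
        · have : (1 : ℝ) / (2 * Kg) ≤ 1 / Kg :=
            div_le_div_of_nonneg_left zero_le_one (by positivity) (by linarith [(Nat.cast_pos.2 hK0 : (0:ℝ) < Kg)])
          linarith

/-- **`α ≤ α̃`** once the precision beats the grid: `2·(2K_g + 1) ≤ 2ᵖ` (then
`λ_p ≥ 1 − 2⁻ᵖ ≥ 1 − 1/(2(2K_g+1))` and `(1 − 1/(2(2K_g+1)))(1 + 1/(2K_g)) ≥ 1`). [folklore] -/
theorem le_gridWidth {α : ℝ} (hα : 0 ≤ α) {Kg p : ℕ} (hKg : 0 < Kg) (hp : 2 * (2 * Kg + 1) ≤ 2 ^ p) :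
    α ≤ gridWidth α Kg p := by
  unfold gridWidth
  have hK : (0 : ℝ) < Kg := Nat.cast_pos.2 hKg
  have hp' : (2 : ℝ) * (2 * Kg + 1) ≤ 2 ^ p := by exact_mod_cast hp
  have h2p : (0 : ℝ) < 2 ^ p := by positivity
  -- `λ ≥ 1 − 2⁻ᵖ ≥ 1 − 1/(2(2K+1))`
  have hlam : 1 - 1 / (2 * (2 * (Kg : ℝ) + 1)) ≤ lam p := by
    refine le_trans ?_ (one_sub_le_lam p)
    have : (1 : ℝ) / 2 ^ p ≤ 1 / (2 * (2 * Kg + 1)) := div_le_div_of_nonneg_left zero_le_one (by positivity) hp'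
    linarith
  have hprod : (1 : ℝ) ≤ (1 - 1 / (2 * (2 * Kg + 1))) * (1 + 1 / (2 * Kg)) := by
    rw [show (1 - 1 / (2 * (2 * (Kg : ℝ) + 1))) * (1 + 1 / (2 * Kg)) =
      1 + (2 * Kg + 1 - Kg - 1 / 2) / (2 * (2 * Kg + 1) * Kg) by field_simp; ring]
    have : (0 : ℝ) ≤ (2 * Kg + 1 - Kg - 1 / 2) / (2 * (2 * Kg + 1) * Kg) := by
      apply div_nonneg <;> nlinarith
    linarith
  calc α = 1 * α := (one_mul α).symm
    _ ≤ (1 - 1 / (2 * (2 * Kg + 1))) * (1 + 1 / (2 * Kg)) * α := mul_le_mul_of_nonneg_right hprod hα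
    _ ≤ lam p * (1 + 1 / (2 * Kg)) * α := by
        refine mul_le_mul_of_nonneg_right (mul_le_mul_of_nonneg_right hlam (by positivity)) hα
    _ = lam p * ((1 + 1 / (2 * Kg)) * α) := by ring

/-! ### The sampler's parameter and the realised width -/

/-- **The rational parameter handed to the rejection sampler** for a target width `L·√σsq`:
`θ = π⁺_p/(L²·σsq)`. [cite: Regev2009, §2 p. 11 (finite precision)] -/
def theta (p L : ℕ) (σsq : ℚ) : ℚ := piUpper p / ((L : ℚ) ^ 2 * σsq)

/-- `0 < θ` for `L, σsq > 0`. [folklore] -/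
theorem theta_pos (p : ℕ) {L : ℕ} (hL : 0 < L) {σsq : ℚ} (hσ : 0 < σsq) : 0 < theta p L σsq := by
  unfold theta
  have : (0 : ℚ) < piUpper p := by exact_mod_cast (show (0 : ℝ) < piUpper p from piUpper_pos p)
  positivity

/-- **The realised width**: the sampler at `θ` draws `D_{ℤ,√(π/θ)}` and `√(π/θ) = λ_p · L · √σsq`.
[cite: Regev2009, §2 p. 11 (finite precision)] -/
theorem sqrt_pi_div_theta (p : ℕ) {L : ℕ} (hL : 0 < L) {σsq : ℚ} (hσ : 0 < σsq) :
    Real.sqrt (π / (theta p L σsq : ℚ)) = lam p * L * Real.sqrt σsq := by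
  have hpu := piUpper_pos p
  have hLr : (0 : ℝ) < L := Nat.cast_pos.2 hL
  have hσr : (0 : ℝ) < (σsq : ℝ) := by exact_mod_cast hσ
  unfold theta lam
  push_cast
  rw [div_div_eq_mul_div, show π * ((L : ℝ) ^ 2 * (σsq : ℝ)) / (piUpper p : ℝ) =
      (π / piUpper p) * ((L : ℝ) * Real.sqrt σsq) ^ 2 by
        rw [mul_pow, Real.sq_sqrt hσr.le]; ring,
    Real.sqrt_mul (div_pos pi_pos hpu).le, Real.sqrt_sq (by positivity)]
  ring

end Widths

end Regev2009

end Literature.Computability.Cryptography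

end
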